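import Mathlib.Data.Complex.Basic
import Mathlib.LinearAlgebra.Matrix.Trace
import Mathlib.LinearAlgebra.Matrix.NonsingularInverse
import Mathlib.Tactic.NoncommRing
import Mathlib.Tactic.Abel
import HarnessLib

/-!
# Stub `stub_chainBlock_insertion_algebra` of line `pin-the-infimum` (crux `RobustYangMillsHandover`, 8892)

E2, layer β1 of the fermionic-insertion bricks in Lüscher's transfer-matrix representation of the
QCD torus functional: the ring identities of the Wilson chain blocks with a one-particle insertion.

In Lüscher's time-slice reduction of the Wilson fermion determinant the chain block of slice `t₀`
is `E = (Bh + C) P⁻ − P⁺ W₁′` with the explicit inverse `Ẽ = −W₁ P⁺ + W₁ P⁺ C Bi P⁻ + Bi P⁻`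
(`Bi = Bh⁻¹`), `F = (Bh + C) P⁺ − P⁻ W₂`, and the one-step matrix is the positive core
`M′ = (1 + P⁺ C P⁻)(Bh P⁺ + Bi P⁻)(1 − P⁻ C P⁺)` dressed by the temporal transporters,
`N := −Ẽ F = (W₁ P⁺ + P⁻) M′ (P⁺ + W₂ P⁻)`.  Here `P± = Pp, Pm` are complementary, mutually
annihilating idempotents, `Bh` (with two-sided inverse `Bi`) commutes with them, `C` is the
spin-off-diagonal hopping part (`P⁺ C P⁺ = P⁻ C P⁻ = 0`) and `W₁, W₁′`, `W₂, W₂′` are pairs of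
mutually inverse transporters commuting with `P±`.  A quark-bilinear source `J` at slice `t₀`
produces the insertion `Z_J = Ẽ J (P⁻ + P⁺ N⁻¹)`; conjugating by `S₁ = W₁ P⁺ + P⁻`
(`S₁⁻¹ = W₁′ P⁺ + P⁻`) removes all temporal links.  This file proves, verbatim as registered,

1. `M′ M′ᵢ = 1` and 2. `M′ᵢ M′ = 1` for `M′ᵢ = (1 + P⁻ C P⁺)(Bi P⁺ + Bh P⁻)(1 − P⁺ C P⁻)`;
3. `N Nᵢ = 1` and 4. `Nᵢ N = 1` for `Nᵢ = (P⁺ + W₂′ P⁻) M′ᵢ (W₁′ P⁺ + P⁻)`;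
5. the link-free form `S₁⁻¹ Z_J S₁ = (−P⁺ + P⁺ C Bi P⁻ + Bi P⁻) J (P⁻ + P⁺ M′ᵢ)`;
6. the contraction constant `tr (Ẽ J P⁻) = tr (J Bi P⁻)`.

## Proof

Everything except 6 is a noncommutative-ring identity, proved in an abstract ring
(sub-namespace `StubChainBlockInsertionAlgebra`) and specialised to `Matrix n n ℂ`:
* `(1 − Y)(1 + Y) = (1 + Y)(1 − Y) = 1` for the square-zero sandwiches `Y = P⁻ C P⁺`, `P⁺ C P⁻`
  (`(P⁻ C P⁺)² = P⁻ C (P⁺ P⁻) C P⁺ = 0`);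
* the pair identities `(X P⁺ + Y P⁻)(Y P⁺ + X P⁻) = 1` (`X Y = Y X = 1`),
  `(X P⁺ + P⁻)(Y P⁺ + P⁻) = 1`, `(P⁺ + X P⁻)(P⁺ + Y P⁻) = 1` (`X Y = 1`), all `= P⁺ + P⁻ = 1`;
* hence a product of two triple products collapses from the middle (1–4), after rewriting `−Ẽ F`
  into its dressed form (re-proved here at ring level by the two-pass monomial normalisation of
  the landed `neg_explicitInv_mul_eq_dressed_two`, with an abstract inverse `Bi`);
* for 5: `S₁⁻¹ Ẽ = −P⁺ + P⁺ C Bi P⁻ + Bi P⁻` (`W₁′ W₁ = 1`, `P⁻ W₁ P⁺ = 0`, `P⁻ Bi P⁻ = Bi P⁻`),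
  `P⁺ (P⁺ + W₂′ P⁻) = P⁺`, `(P⁻ + P⁺ M′ᵢ S₁⁻¹) S₁ = P⁻ + P⁺ M′ᵢ`;
* for 6: cyclicity of the trace (`Matrix.trace_mul_cycle`) and `P⁻ Ẽ = Bi P⁻`.

The hypotheses `Pm * C * Pm = 0`, `W₁' * Pm = Pm * W₁'` and `W₂ * Pp = Pp * W₂` of the registered
signature are not needed.  Pure theorem file (no definitions), Mathlib only.

References: M. Lüscher, *Construction of a selfadjoint, strictly positive transfer matrix for
Euclidean lattice gauge theories*, Comm. Math. Phys. 54 (1977) 283–292; I. Montvay, G. Münster,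
*Quantum Fields on a Lattice* (CUP 1994), §4 (transfer matrix for Wilson fermions).
-/

namespace Summit.QuantumFields.QCD.Cruxes.RobustYangMillsHandover.PinTheInfimum

namespace StubChainBlockInsertionAlgebra

section Ring

variable {R : Type*} [Ring R]

/-- Right-associated form of a product relation: `A * B = C` gives `A * (B * X) = C * X`.
[folklore] -/
theorem mul_mul_eq {A B C : R} (h : A * B = C) (X : R) : A * (B * X) = C * X := by
  rw [← mul_assoc, h]

/-- Right-associated form of a commutation relation: `A * B = B * A` gives
`A * (B * X) = B * (A * X)`. [folklore] -/
theorem mul_mul_comm {A B : R} (h : A * B = B * A) (X : R) : A * (B * X) = B * (A * X) := by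
  rw [← mul_assoc, h, mul_assoc]

/-- A two-sided inverse inherits commutation: if `B Bi = 1 = Bi B` and `B P = P B`, then
`Bi P = P Bi`. [folklore] -/
theorem inv_comm_of_comm (B Bi P : R) (h1 : B * Bi = 1) (h2 : Bi * B = 1)
    (h : B * P = P * B) : Bi * P = P * Bi :=
  -- adapted from `ChainBlockInverse.inv_comm_of_comm` (StableActionBridge, line `Sketch`)
  calc Bi * P = Bi * P * (B * Bi) := by rw [h1, mul_one]
    _ = Bi * (B * P) * Bi := by rw [h]; simp only [mul_assoc]
    _ = P * Bi := by rw [← mul_assoc, h2, one_mul]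

/-- `(1 - Y)(1 + Y) = 1` for a square-zero element `Y`. [folklore] -/
theorem one_sub_mul_one_add {Y : R} (h : Y * Y = 0) : (1 - Y) * (1 + Y) = 1 := by
  rw [sub_mul, one_mul, mul_add, mul_one, h, add_zero, add_sub_cancel_right]

/-- `(1 + Y)(1 - Y) = 1` for a square-zero element `Y`. [folklore] -/
theorem one_add_mul_one_sub {Y : R} (h : Y * Y = 0) : (1 + Y) * (1 - Y) = 1 := by
  rw [add_mul, one_mul, mul_sub, mul_one, h, sub_zero, sub_add_cancel]

/-- The sandwich `A C B` squares to zero as soon as `B A = 0`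
(e.g. `(P⁻ C P⁺)² = P⁻ C (P⁺ P⁻) C P⁺ = 0`). [folklore] -/
theorem sandwich_sq_eq_zero (A C B : R) (h : B * A = 0) : A * C * B * (A * C * B) = 0 := by
  calc A * C * B * (A * C * B) = A * C * (B * A) * (C * B) := by simp only [mul_assoc]
    _ = 0 := by rw [h, mul_zero, zero_mul]

/-- A product of two triple products collapses from the middle:
`(a b c)(a′ b′ c′) = 1` if `c a′ = 1`, `b b′ = 1`, `a c′ = 1`. [folklore] -/
theorem triple_mul_triple_eq_one (a b c a' b' c' : R) (h1 : c * a' = 1) (h2 : b * b' = 1)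
    (h3 : a * c' = 1) : a * b * c * (a' * b' * c') = 1 := by
  calc a * b * c * (a' * b' * c') = a * (b * (c * a' * (b' * c'))) := by simp only [mul_assoc]
    _ = 1 := by rw [h1, one_mul, ← mul_assoc b b' c', h2, one_mul, h3]

/-- **Cross pair identity**: for complementary mutually annihilating idempotents `P`, `Q` and
mutually inverse `X`, `Y` with `Y P = P Y`, `X Q = Q X`,
`(X P + Y Q)(Y P + X Q) = P + Q = 1`. [folklore] -/
theorem cross_pair_mul (P Q X Y : R) (h1 : P + Q = 1) (hPP : P * P = P) (hQQ : Q * Q = Q)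
    (hPQ : P * Q = 0) (hQP : Q * P = 0) (hXY : X * Y = 1) (hYX : Y * X = 1)
    (hYP : Y * P = P * Y) (hXQ : X * Q = Q * X) :
    (X * P + Y * Q) * (Y * P + X * Q) = 1 := by
  have e1 : X * P * (Y * P) = P := by
    rw [mul_assoc, ← mul_assoc P, ← hYP, mul_assoc Y, hPP, ← mul_assoc, hXY, one_mul]
  have e2 : X * P * (X * Q) = 0 := by
    rw [hXQ, mul_assoc, ← mul_assoc P, hPQ, zero_mul, mul_zero]
  have e3 : Y * Q * (Y * P) = 0 := by
    rw [hYP, mul_assoc, ← mul_assoc Q, hQP, zero_mul, mul_zero]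
  have e4 : Y * Q * (X * Q) = Q := by
    rw [mul_assoc, ← mul_assoc Q, ← hXQ, mul_assoc X, hQQ, ← mul_assoc, hYX, one_mul]
  rw [add_mul, mul_add, mul_add, e1, e2, e3, e4, add_zero, zero_add, h1]

/-- **Left-dressed pair identity**: `(X P + Q)(Y P + Q) = P + Q = 1` for `X Y = 1`,
`Y P = P Y`. [folklore] -/
theorem left_pair_mul (P Q X Y : R) (h1 : P + Q = 1) (hPP : P * P = P) (hQQ : Q * Q = Q)
    (hPQ : P * Q = 0) (hQP : Q * P = 0) (hXY : X * Y = 1) (hYP : Y * P = P * Y) :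
    (X * P + Q) * (Y * P + Q) = 1 := by
  have e1 : X * P * (Y * P) = P := by
    rw [mul_assoc, ← mul_assoc P, ← hYP, mul_assoc Y, hPP, ← mul_assoc, hXY, one_mul]
  have e2 : X * P * Q = 0 := by rw [mul_assoc, hPQ, mul_zero]
  have e3 : Q * (Y * P) = 0 := by rw [hYP, ← mul_assoc, hQP, zero_mul]
  rw [add_mul, mul_add, mul_add, e1, e2, e3, hQQ, add_zero, zero_add, h1]

/-- **Right-dressed pair identity**: `(P + X Q)(P + Y Q) = P + Q = 1` for `X Y = 1`,
`Y Q = Q Y`. [folklore] -/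
theorem right_pair_mul (P Q X Y : R) (h1 : P + Q = 1) (hPP : P * P = P) (hQQ : Q * Q = Q)
    (hPQ : P * Q = 0) (hQP : Q * P = 0) (hXY : X * Y = 1) (hYQ : Y * Q = Q * Y) :
    (P + X * Q) * (P + Y * Q) = 1 := by
  have e2 : P * (Y * Q) = 0 := by rw [hYQ, ← mul_assoc, hPQ, zero_mul]
  have e3 : X * Q * P = 0 := by rw [mul_assoc, hQP, mul_zero]
  have e4 : X * Q * (Y * Q) = Q := by
    rw [hYQ, mul_assoc, ← mul_assoc Q Q, hQQ, ← hYQ, ← mul_assoc, hXY, one_mul]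
  rw [add_mul, mul_add, mul_add, hPP, e2, e3, e4, add_zero, zero_add, h1]

/-- `P (P + X Q) = P` for `P² = P`, `P Q = 0`, `X P = P X`. [folklore] -/
theorem proj_mul_right_dress (P Q X : R) (hPP : P * P = P) (hPQ : P * Q = 0)
    (hXP : X * P = P * X) : P * (P + X * Q) = P := by
  rw [mul_add, hPP, ← mul_assoc, ← hXP, mul_assoc, hPQ, mul_zero, add_zero]

/-- `Q (X P + Q) = Q` for `Q² = Q`, `Q P = 0`, `X Q = Q X`. [folklore] -/
theorem proj_mul_left_dress (P Q X : R) (hQQ : Q * Q = Q) (hQP : Q * P = 0)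
    (hXQ : X * Q = Q * X) : Q * (X * P + Q) = Q := by
  rw [mul_add, hQQ, ← mul_assoc, ← hXQ, mul_assoc, hQP, mul_zero, zero_add]

/-- **1. The positive core and its explicit inverse**: `M′ M′ᵢ = 1` for
`M′ = (1 + P C Q)(B P + Bi Q)(1 − Q C P)`, `M′ᵢ = (1 + Q C P)(Bi P + B Q)(1 − P C Q)`
(`(1 − QCP)(1 + QCP) = 1`, `(BP + BiQ)(BiP + BQ) = 1`, `(1 + PCQ)(1 − PCQ) = 1`).
[cite: Luscher1977, pp. 283–292] -/
theorem core_mul_coreInv (P Q B Bi C : R) (h1 : P + Q = 1) (hPP : P * P = P)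
    (hQQ : Q * Q = Q) (hPQ : P * Q = 0) (hQP : Q * P = 0) (hBBi : B * Bi = 1) (hBiB : Bi * B = 1)
    (hBP : B * P = P * B) (hBQ : B * Q = Q * B) :
    (1 + P * C * Q) * (B * P + Bi * Q) * (1 - Q * C * P) *
        ((1 + Q * C * P) * (Bi * P + B * Q) * (1 - P * C * Q)) = 1 :=
  triple_mul_triple_eq_one _ _ _ _ _ _ (one_sub_mul_one_add (sandwich_sq_eq_zero Q C P hPQ))
    (cross_pair_mul P Q B Bi h1 hPP hQQ hPQ hQP hBBi hBiB (inv_comm_of_comm B Bi P hBBi hBiB hBP)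
      hBQ)
    (one_add_mul_one_sub (sandwich_sq_eq_zero P C Q hQP))

/-- **2. The explicit inverse is also a left inverse of the positive core**: `M′ᵢ M′ = 1`.
[cite: Luscher1977, pp. 283–292] -/
theorem coreInv_mul_core (P Q B Bi C : R) (h1 : P + Q = 1) (hPP : P * P = P)
    (hQQ : Q * Q = Q) (hPQ : P * Q = 0) (hQP : Q * P = 0) (hBBi : B * Bi = 1) (hBiB : Bi * B = 1)
    (hBP : B * P = P * B) (hBQ : B * Q = Q * B) :
    (1 + Q * C * P) * (Bi * P + B * Q) * (1 - P * C * Q) *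
        ((1 + P * C * Q) * (B * P + Bi * Q) * (1 - Q * C * P)) = 1 :=
  triple_mul_triple_eq_one _ _ _ _ _ _ (one_sub_mul_one_add (sandwich_sq_eq_zero P C Q hQP))
    (cross_pair_mul P Q Bi B h1 hPP hQQ hPQ hQP hBiB hBBi hBP (inv_comm_of_comm B Bi Q hBBi hBiB hBQ))
    (one_add_mul_one_sub (sandwich_sq_eq_zero Q C P hPQ))

/-- **Dressed form of the one-step matrix** (ring level, abstract inverse `Bi` of `B` commuting
with `Q`): `−Ẽ F = (W₁ P + Q) M′ (P + W₂ Q)` for `Ẽ = −W₁ P + W₁ P C Bi Q + Bi Q`,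
`F = (B + C) P − Q W₂`.  Two-pass monomial normalisation as in the landed
`neg_explicitInv_mul_eq_dressed_two`. [cite: Luscher1977, pp. 283–292] -/
theorem neg_explicitInv_mul_eq_dressed_of_ring (P Q B Bi C W₁ W₂ : R) (hPP : P * P = P)
    (hQQ : Q * Q = Q) (hPQ : P * Q = 0) (hQP : Q * P = 0) (hBP : B * P = P * B)
    (hBiQ : Bi * Q = Q * Bi) (hPCP : P * C * P = 0) (hW₂Q : W₂ * Q = Q * W₂) :
    -(-W₁ * P + W₁ * P * C * Bi * Q + Bi * Q) * ((B + C) * P - Q * W₂) =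
      (W₁ * P + Q) * ((1 + P * C * Q) * (B * P + Bi * Q) * (1 - Q * C * P)) * (P + W₂ * Q) := by
  -- adapted from `neg_explicitInv_mul_eq_dressed_two` (StableActionBridge, line `Sketch`)
  have hPCP' : P * (C * P) = 0 := by rw [← mul_assoc, hPCP]
  -- step 1: distribute into right-associated monomials
  simp only [mul_add, add_mul, mul_sub, sub_mul, neg_mul, one_mul, mul_one, mul_assoc]
  -- step 2: normalise each monomial (projections move left through `B`, `Bi`, `W₂`)
  simp only [hPP, hQP, hBP, hW₂Q, hPCP', mul_mul_eq hPP, mul_mul_eq hQQ, mul_mul_eq hPQ,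
    mul_mul_eq hQP, mul_mul_comm hBiQ, mul_zero, zero_mul, neg_zero, add_zero, zero_add, sub_zero]
  abel

/-- **3. The dressed one-step matrix and its explicit inverse**: `N Nᵢ = 1` for
`N = −Ẽ F = (W₁ P + Q) M′ (P + W₂ Q)` and `Nᵢ = (P + W₂′ Q) M′ᵢ (W₁′ P + Q)`
(`(P + W₂Q)(P + W₂′Q) = 1`, `M′ M′ᵢ = 1`, `(W₁P + Q)(W₁′P + Q) = 1`).
[cite: Luscher1977, pp. 283–292] -/
theorem oneStep_mul_oneStepInv (P Q B Bi C W₁ W₁' W₂ W₂' : R) (h1 : P + Q = 1)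
    (hPP : P * P = P) (hQQ : Q * Q = Q) (hPQ : P * Q = 0) (hQP : Q * P = 0) (hBBi : B * Bi = 1)
    (hBiB : Bi * B = 1) (hBP : B * P = P * B) (hBQ : B * Q = Q * B) (hPCP : P * C * P = 0)
    (hW₁'P : W₁' * P = P * W₁') (hW₂Q : W₂ * Q = Q * W₂) (hW₂'Q : W₂' * Q = Q * W₂')
    (hW₁W₁' : W₁ * W₁' = 1) (hW₂W₂' : W₂ * W₂' = 1) :
    -(-W₁ * P + W₁ * P * C * Bi * Q + Bi * Q) * ((B + C) * P - Q * W₂) *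
        ((P + W₂' * Q) * ((1 + Q * C * P) * (Bi * P + B * Q) * (1 - P * C * Q)) *
          (W₁' * P + Q)) = 1 := by
  rw [neg_explicitInv_mul_eq_dressed_of_ring P Q B Bi C W₁ W₂ hPP hQQ hPQ hQP hBP
    (inv_comm_of_comm B Bi Q hBBi hBiB hBQ) hPCP hW₂Q]
  exact triple_mul_triple_eq_one _ _ _ _ _ _
    (right_pair_mul P Q W₂ W₂' h1 hPP hQQ hPQ hQP hW₂W₂' hW₂'Q)
    (core_mul_coreInv P Q B Bi C h1 hPP hQQ hPQ hQP hBBi hBiB hBP hBQ)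
    (left_pair_mul P Q W₁ W₁' h1 hPP hQQ hPQ hQP hW₁W₁' hW₁'P)

/-- **4. The explicit inverse is also a left inverse of the dressed one-step matrix**:
`Nᵢ N = 1` (`(W₁′P + Q)(W₁P + Q) = 1`, `M′ᵢ M′ = 1`, `(P + W₂′Q)(P + W₂Q) = 1`).
[cite: Luscher1977, pp. 283–292] -/
theorem oneStepInv_mul_oneStep (P Q B Bi C W₁ W₁' W₂ W₂' : R) (h1 : P + Q = 1)
    (hPP : P * P = P) (hQQ : Q * Q = Q) (hPQ : P * Q = 0) (hQP : Q * P = 0) (hBBi : B * Bi = 1)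
    (hBiB : Bi * B = 1) (hBP : B * P = P * B) (hBQ : B * Q = Q * B) (hPCP : P * C * P = 0)
    (hW₁P : W₁ * P = P * W₁) (hW₂Q : W₂ * Q = Q * W₂) (hW₁'W₁ : W₁' * W₁ = 1)
    (hW₂'W₂ : W₂' * W₂ = 1) :
    (P + W₂' * Q) * ((1 + Q * C * P) * (Bi * P + B * Q) * (1 - P * C * Q)) * (W₁' * P + Q) *
        (-(-W₁ * P + W₁ * P * C * Bi * Q + Bi * Q) * ((B + C) * P - Q * W₂)) = 1 := by
  rw [neg_explicitInv_mul_eq_dressed_of_ring P Q B Bi C W₁ W₂ hPP hQQ hPQ hQP hBP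
    (inv_comm_of_comm B Bi Q hBBi hBiB hBQ) hPCP hW₂Q]
  exact triple_mul_triple_eq_one _ _ _ _ _ _
    (left_pair_mul P Q W₁' W₁ h1 hPP hQQ hPQ hQP hW₁'W₁ hW₁P)
    (coreInv_mul_core P Q B Bi C h1 hPP hQQ hPQ hQP hBBi hBiB hBP hBQ)
    (right_pair_mul P Q W₂' W₂ h1 hPP hQQ hPQ hQP hW₂'W₂ hW₂Q)

/-- **Undressing the explicit inverse from the left**:
`(W₁′ P + Q) Ẽ = −P + P C Bi Q + Bi Q` (`W₁′ W₁ = 1`, `Q W₁ P = 0`, `P Bi Q = 0`,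
`Q Bi Q = Bi Q`). [folklore] -/
theorem leftUndress_mul_explicitInv (P Q Bi C W₁ W₁' : R) (hPP : P * P = P) (hQQ : Q * Q = Q)
    (hPQ : P * Q = 0) (hQP : Q * P = 0) (hBiP : Bi * P = P * Bi) (hBiQ : Bi * Q = Q * Bi)
    (hW₁P : W₁ * P = P * W₁) (hW₁Q : W₁ * Q = Q * W₁) (hW₁'W₁ : W₁' * W₁ = 1) :
    (W₁' * P + Q) * (-W₁ * P + W₁ * P * C * Bi * Q + Bi * Q) = -P + P * C * Bi * Q + Bi * Q := by
  -- step 1: distribute into right-associated monomials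
  simp only [mul_add, add_mul, neg_mul, mul_neg, mul_assoc]
  -- step 2: normalise each monomial (projections move right through `W₁`, `Bi`)
  simp only [hPP, hQQ, hPQ, hQP, mul_mul_eq hPP, mul_mul_eq hQP, mul_mul_comm hW₁P.symm,
    mul_mul_comm hW₁Q.symm, mul_mul_comm hBiP.symm, mul_mul_comm hBiQ.symm, mul_mul_eq hW₁'W₁,
    one_mul, mul_zero, zero_mul, add_zero, zero_add]

/-- Assembly of the link-free insertion: if `Sᵢ E = K`, `P T = P`, `Sᵢ S = 1`, `Q S = Q`, then
`Sᵢ (E J (Q + P (T M Sᵢ))) S = K J (Q + P M)`. [folklore] -/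
theorem undress_insertion (P Q M T S Sᵢ E K J : R) (hK : Sᵢ * E = K) (hPT : P * T = P)
    (hSS : Sᵢ * S = 1) (hQS : Q * S = Q) :
    Sᵢ * (E * J * (Q + P * (T * M * Sᵢ))) * S = K * J * (Q + P * M) := by
  have e : P * (T * M * Sᵢ) * S = P * M := by
    calc P * (T * M * Sᵢ) * S = P * T * M * (Sᵢ * S) := by simp only [mul_assoc]
      _ = P * M := by rw [hPT, hSS, mul_one]
  calc Sᵢ * (E * J * (Q + P * (T * M * Sᵢ))) * S
        = Sᵢ * E * J * ((Q + P * (T * M * Sᵢ)) * S) := by simp only [mul_assoc]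
    _ = K * J * (Q + P * M) := by rw [hK, add_mul, hQS, e]

/-- **5. The link-free form of the conjugated insertion**: with `S₁ = W₁ P + Q`,
`S₁⁻¹ = W₁′ P + Q`, `Nᵢ = (P + W₂′ Q) M′ᵢ (W₁′ P + Q)`,
`S₁⁻¹ · Ẽ J (Q + P Nᵢ) · S₁ = (−P + P C Bi Q + Bi Q) J (Q + P M′ᵢ)` — no temporal link survives.
[cite: Luscher1977, pp. 283–292] -/
theorem undress_insertion_eq (P Q B Bi C W₁ W₁' W₂' J : R) (h1 : P + Q = 1) (hPP : P * P = P)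
    (hQQ : Q * Q = Q) (hPQ : P * Q = 0) (hQP : Q * P = 0) (hBBi : B * Bi = 1) (hBiB : Bi * B = 1)
    (hBP : B * P = P * B) (hBQ : B * Q = Q * B) (hW₁P : W₁ * P = P * W₁) (hW₁Q : W₁ * Q = Q * W₁)
    (hW₂'P : W₂' * P = P * W₂') (hW₁'W₁ : W₁' * W₁ = 1) :
    (W₁' * P + Q) * ((-W₁ * P + W₁ * P * C * Bi * Q + Bi * Q) * J *
        (Q + P * ((P + W₂' * Q) * ((1 + Q * C * P) * (Bi * P + B * Q) * (1 - P * C * Q)) *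
          (W₁' * P + Q)))) * (W₁ * P + Q) =
      (-P + P * C * Bi * Q + Bi * Q) * J *
        (Q + P * ((1 + Q * C * P) * (Bi * P + B * Q) * (1 - P * C * Q))) :=
  undress_insertion P Q _ _ _ _ _ _ J
    (leftUndress_mul_explicitInv P Q Bi C W₁ W₁' hPP hQQ hPQ hQP
      (inv_comm_of_comm B Bi P hBBi hBiB hBP) (inv_comm_of_comm B Bi Q hBBi hBiB hBQ) hW₁P hW₁Q
      hW₁'W₁)
    (proj_mul_right_dress P Q W₂' hPP hPQ hW₂'P)
    (left_pair_mul P Q W₁' W₁ h1 hPP hQQ hPQ hQP hW₁'W₁ hW₁P)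
    (proj_mul_left_dress P Q W₁ hQQ hQP hW₁Q)

/-- `Q Ẽ = Bi Q` for the explicit inverse `Ẽ = −W₁ P + W₁ P C Bi Q + Bi Q`
(`Q W₁ P = W₁ Q P = 0`, `Q Bi Q = Bi Q`). [folklore] -/
theorem proj_mul_explicitInv (P Q Bi C W₁ : R) (hQQ : Q * Q = Q) (hQP : Q * P = 0)
    (hBiQ : Bi * Q = Q * Bi) (hW₁Q : W₁ * Q = Q * W₁) :
    Q * (-W₁ * P + W₁ * P * C * Bi * Q + Bi * Q) = Bi * Q := by
  have e1 : Q * (W₁ * P) = 0 := by rw [← mul_assoc, ← hW₁Q, mul_assoc, hQP, mul_zero]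
  have e2 : Q * (W₁ * P * C * Bi * Q) = 0 := by
    calc Q * (W₁ * P * C * Bi * Q) = Q * (W₁ * P) * (C * Bi * Q) := by simp only [mul_assoc]
      _ = 0 := by rw [e1, zero_mul]
  have e3 : Q * (Bi * Q) = Bi * Q := by rw [← mul_assoc, ← hBiQ, mul_assoc, hQQ]
  rw [mul_add, mul_add, neg_mul, mul_neg, e1, neg_zero, zero_add, e2, zero_add, e3]

end Ring

/-- **6. The contraction constant**: `tr (Ẽ J P⁻) = tr (J Bi P⁻)` (cyclicity of the trace and
`P⁻ Ẽ = Bi P⁻`). [cite: Luscher1977, pp. 283–292] -/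
theorem trace_explicitInv_insertion {n : Type*} [Fintype n] [DecidableEq n]
    (Pp Pm Bi C W₁ J : Matrix n n ℂ)
    (hQQ : Pm * Pm = Pm) (hQP : Pm * Pp = 0) (hBiQ : Bi * Pm = Pm * Bi)
    (hW₁Q : W₁ * Pm = Pm * W₁) :
    ((-W₁ * Pp + W₁ * Pp * C * Bi * Pm + Bi * Pm) * J * Pm).trace = (J * Bi * Pm).trace := by
  have hQE : Pm * (-W₁ * Pp + W₁ * Pp * C * Bi * Pm + Bi * Pm) = Bi * Pm :=
    proj_mul_explicitInv Pp Pm Bi C W₁ hQQ hQP hBiQ hW₁Q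
  calc ((-W₁ * Pp + W₁ * Pp * C * Bi * Pm + Bi * Pm) * J * Pm).trace
        = (Pm * (-W₁ * Pp + W₁ * Pp * C * Bi * Pm + Bi * Pm) * J).trace :=
          Matrix.trace_mul_cycle _ _ _
    _ = (J * Bi * Pm).trace := by rw [hQE]; exact Matrix.trace_mul_cycle _ _ _

end StubChainBlockInsertionAlgebra

open StubChainBlockInsertionAlgebra in
/-- **E2 β1: ring identities of the Wilson chain blocks with an insertion.**  For complementary
mutually annihilating idempotents `Pp`, `Pm`, an operator `Bh` with two-sided inverse `Bi`
commuting with them, a hopping part `C` with `Pp C Pp = Pm C Pm = 0`, mutually inverse transporter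
pairs `W₁, W₁′` and `W₂, W₂′` commuting with `Pp`, `Pm`, and an arbitrary source `J`:
(1, 2) `M′ᵢ = (1 + PmCPp)(BiPp + BhPm)(1 − PpCPm)` is the two-sided inverse of Lüscher's positive
core `M′ = (1 + PpCPm)(BhPp + BiPm)(1 − PmCPp)`; (3, 4) `Nᵢ = (Pp + W₂′Pm) M′ᵢ (W₁′Pp + Pm)` is the
two-sided inverse of the one-step matrix `N = −Ẽ F`, `Ẽ = −W₁Pp + W₁PpC Bi Pm + Bi Pm`,
`F = (Bh + C)Pp − Pm W₂`; (5) conjugating the insertion `Ẽ J (Pm + Pp Nᵢ)` by `S₁ = W₁Pp + Pm`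
removes all temporal links, `S₁⁻¹ Ẽ J (Pm + Pp Nᵢ) S₁ = (−Pp + PpC Bi Pm + Bi Pm) J (Pm + Pp M′ᵢ)`;
(6) `tr (Ẽ J Pm) = tr (J Bi Pm)`.  The statement is the registered stub signature verbatim (its
hypotheses `Pm * C * Pm = 0`, `W₁' * Pm = Pm * W₁'`, `W₂ * Pp = Pp * W₂` are not used).
[cite: Luscher1977, pp. 283–292] -/
theorem stub_chainBlock_insertion_algebra :
    ∀ (n : Type) [Fintype n] [DecidableEq n] (Pp Pm Bh Bi C W₁ W₁' W₂ W₂' J : Matrix n n ℂ),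
      Pp + Pm = 1 → Pp * Pp = Pp → Pm * Pm = Pm → Pp * Pm = 0 → Pm * Pp = 0 →
      Bh * Bi = 1 → Bi * Bh = 1 → Bh * Pp = Pp * Bh → Bh * Pm = Pm * Bh →
      Pp * C * Pp = 0 → Pm * C * Pm = 0 →
      W₁ * Pp = Pp * W₁ → W₁ * Pm = Pm * W₁ → W₁' * Pp = Pp * W₁' → W₁' * Pm = Pm * W₁' →
      W₂ * Pp = Pp * W₂ → W₂ * Pm = Pm * W₂ → W₂' * Pp = Pp * W₂' → W₂' * Pm = Pm * W₂' →
      W₁' * W₁ = 1 → W₁ * W₁' = 1 → W₂' * W₂ = 1 → W₂ * W₂' = 1 →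
      ((1 + Pp * C * Pm) * (Bh * Pp + Bi * Pm) * (1 - Pm * C * Pp)) *
          ((1 + Pm * C * Pp) * (Bi * Pp + Bh * Pm) * (1 - Pp * C * Pm)) = 1 ∧
      ((1 + Pm * C * Pp) * (Bi * Pp + Bh * Pm) * (1 - Pp * C * Pm)) *
          ((1 + Pp * C * Pm) * (Bh * Pp + Bi * Pm) * (1 - Pm * C * Pp)) = 1 ∧
      (-(-W₁ * Pp + W₁ * Pp * C * Bi * Pm + Bi * Pm) * ((Bh + C) * Pp - Pm * W₂)) *
          ((Pp + W₂' * Pm) * ((1 + Pm * C * Pp) * (Bi * Pp + Bh * Pm) * (1 - Pp * C * Pm)) * (W₁' * Pp + Pm)) = 1 ∧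
      ((Pp + W₂' * Pm) * ((1 + Pm * C * Pp) * (Bi * Pp + Bh * Pm) * (1 - Pp * C * Pm)) * (W₁' * Pp + Pm)) *
          (-(-W₁ * Pp + W₁ * Pp * C * Bi * Pm + Bi * Pm) * ((Bh + C) * Pp - Pm * W₂)) = 1 ∧
      (W₁' * Pp + Pm) * ((-W₁ * Pp + W₁ * Pp * C * Bi * Pm + Bi * Pm) * J *
          (Pm + Pp * ((Pp + W₂' * Pm) * ((1 + Pm * C * Pp) * (Bi * Pp + Bh * Pm) * (1 - Pp * C * Pm)) *
            (W₁' * Pp + Pm)))) * (W₁ * Pp + Pm) =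
        (-Pp + Pp * C * Bi * Pm + Bi * Pm) * J *
          (Pm + Pp * ((1 + Pm * C * Pp) * (Bi * Pp + Bh * Pm) * (1 - Pp * C * Pm))) ∧
      ((-W₁ * Pp + W₁ * Pp * C * Bi * Pm + Bi * Pm) * J * Pm).trace = (J * Bi * Pm).trace := by
  intro n _ _ Pp Pm Bh Bi C W₁ W₁' W₂ W₂' J h1 hPP hQQ hPQ hQP hBBi hBiB hBP hBQ hPCP _hQCQ hW₁P
    hW₁Q hW₁'P _hW₁'Q _hW₂P hW₂Q hW₂'P hW₂'Q hW₁'W₁ hW₁W₁' hW₂'W₂ hW₂W₂'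
  exact ⟨core_mul_coreInv Pp Pm Bh Bi C h1 hPP hQQ hPQ hQP hBBi hBiB hBP hBQ,
    coreInv_mul_core Pp Pm Bh Bi C h1 hPP hQQ hPQ hQP hBBi hBiB hBP hBQ,
    oneStep_mul_oneStepInv Pp Pm Bh Bi C W₁ W₁' W₂ W₂' h1 hPP hQQ hPQ hQP hBBi hBiB hBP hBQ hPCP
      hW₁'P hW₂Q hW₂'Q hW₁W₁' hW₂W₂',
    oneStepInv_mul_oneStep Pp Pm Bh Bi C W₁ W₁' W₂ W₂' h1 hPP hQQ hPQ hQP hBBi hBiB hBP hBQ hPCP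
      hW₁P hW₂Q hW₁'W₁ hW₂'W₂,
    undress_insertion_eq Pp Pm Bh Bi C W₁ W₁' W₂' J h1 hPP hQQ hPQ hQP hBBi hBiB hBP hBQ hW₁P hW₁Q
      hW₂'P hW₁'W₁,
    trace_explicitInv_insertion Pp Pm Bi C W₁ J hQQ hQP (inv_comm_of_comm Bh Bi Pm hBBi hBiB hBQ)
      hW₁Q⟩

end Summit.QuantumFields.QCD.Cruxes.RobustYangMillsHandover.PinTheInfimum
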